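import Literature.AnabelianGeometry.SemiGraphs.PSCRamification
import Literature.AnabelianGeometry.SemiGraphs.PSCProofs
import Literature.AnabelianGeometry.SemiGraphs.PSCCountingLemmas

/-!
# The numerical ramification criteria of [CombGC] Rmk. 1.4.2 / [IUTchI] Rmk. 1.2.3 (iii), (iv), proved

Mochizuki, *A combinatorial version of the Grothendieck conjecture*, Tohoku Math. J. **59** (2007)
[CombGC], §1, Remark 1.4.2 (author's manuscript p. 11), with the amended text [IUTchI] Remark
1.2.3 (iii) (p. 41): for a Galois finite étale covering `G' → G` of degree a positive power of `l`,
`G` of pro-Σ PSC-type, `Σ = {l}`, "one verifies immediately that"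

* `G' → G` is cuspidally purely totally ramified iff `r(G') = deg(G'/G) · (r(G) − 1) + 1`;
* if `G' → G` is a `Π^unr_G`-covering [so `n(G') = deg(G'/G) · n(G)`], it is verticially purely
  totally ramified iff `i(G') = deg(G'/G) · (i(G) − 1) + 1`, equivalently
  `i(G') − n(G') = deg(G'/G) · (i(G) − n(G) − 1) + 1`;

and [IUTchI] Remark 1.2.3 (iv), p. 42, second verticial claim: an elementary abelian quotient of
`M^unr_G` "corresponds to a verticially purely totally ramified covering of `G` if and only if
there exists a vertex `v` of `G` such that `φ(M^unr_G[v]) = Q`, `φ(M^unr_G[v']) = 0` for all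
`v' ≠ v`".  `PSCRamification.lean` types these as the named facts
`PSCDatum.CuspidalPureRamificationCount`, `VerticialPureRamificationCount`,
`VerticialMinusNodalCount` (bundled over the origin parameter as `RamificationCountsHold Ω`) and
`ElementaryQuotientVerticiallyRamifiedIff`.  This file PROVES them — for every datum
`G : PSCDatum Π`, hence `RamificationCountsHold Ω` for every `Ω` — by the verification the text
alludes to: for `H' ⊴ Π_G` of index `l ^ k` the cusps of `G' = G_{H'}` over the cusp `c` number
`[Π_G : H' · Π_c] = l ^ k / f_c` (`PSCProofs.lean`), "purely totally ramified at `c`" reads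
`f_c = l ^ k ∧ ∀ c' ≠ c, f_{c'} = 1`, and the arithmetic is `PSCCountingLemmas.sum_quot_eq_iff`.
[cite: MochizukiCombGC2007, Rmk 1.4.2 p.11] [cite: Mochizuki2012, IUTchI Rmk 1.2.3(iii)-(iv) pp.41-42]

Companion `PSCRamificationCyclicProofs.lean`: the cyclic criterion of [IUTchI] Rmk. 1.2.3 (iii),
Rmk. 1.4.4 / Rmk. 1.2.3 (v).  Pure proofs; no definitions; nothing here takes a side on
[IUTchIII] Cor. 3.12.
-/

noncomputable section

namespace Literature.AnabelianGeometry.SemiGraphs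

namespace PSCDatum

open scoped Pointwise

universe u

variable {P : Type u} [Group P] [TopologicalSpace P]

/-! ### Conjugation bookkeeping -/

section Conj

omit [TopologicalSpace P] in
/-- Everything lies in the double coset `Π · a · K`. [cite: MochizukiCombGC2007, Def 1.4(v) p.11] -/
theorem mem_doubleCoset_top (a x : P) (K : Subgroup P) :
    x ∈ DoubleCoset.doubleCoset a ((⊤ : Subgroup P) : Set P) (K : Set P) :=
  DoubleCoset.mem_doubleCoset.mpr ⟨x * a⁻¹, Subgroup.mem_top _, 1, K.one_mem, by group⟩

omit [TopologicalSpace P] in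
/-- `γ Π γ⁻¹ = Π`. [cite: MochizukiCombGC2007, Def 1.1(ii) p.6] -/
theorem conjAct_smul_top (γ : ConjAct P) : γ • (⊤ : Subgroup P) = ⊤ :=
  top_le_iff.mp fun x _ =>
    (Subgroup.mem_smul_pointwise_iff_exists x γ ⊤).mpr ⟨γ⁻¹ • x, Subgroup.mem_top _, smul_inv_smul γ x⟩

omit [TopologicalSpace P] in
/-- For `N ⊴ Π`: `γKγ⁻¹ · N = Π ↔ K · N = Π`. [cite: MochizukiCombGC2007, Def 1.4(v) p.11] -/
theorem smul_sup_eq_top_iff (γ : ConjAct P) (K N : Subgroup P) [hN : N.Normal] :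
    γ • K ⊔ N = ⊤ ↔ K ⊔ N = ⊤ := by
  have key : ∀ (δ : ConjAct P) (L : Subgroup P), L ⊔ N = ⊤ → δ • L ⊔ N = ⊤ := fun δ L h => by
    have := congrArg (fun X : Subgroup P => δ • X) h
    simpa only [Subgroup.smul_sup, hN.conjAct, conjAct_smul_top] using this
  refine ⟨fun h => ?_, key γ K⟩
  simpa only [inv_smul_smul] using key γ⁻¹ (γ • K) h

omit [TopologicalSpace P] in
/-- For `N ⊴ Π`: `γKγ⁻¹ ≤ N ↔ K ≤ N`. [cite: MochizukiCombGC2007, Def 1.4(v) p.11] -/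
theorem smul_le_normal_iff (γ : ConjAct P) (K N : Subgroup P) [hN : N.Normal] :
    γ • K ≤ N ↔ K ≤ N := by
  conv_lhs => rw [← hN.conjAct γ]
  exact Subgroup.pointwise_smul_le_pointwise_smul_iff

omit [TopologicalSpace P] in
/-- **Normal form of "purely totally ramified" for a Galois covering of the base** (`H'' = Π_G`,
`H' ⊴ Π_G`; [CombGC] Def. 1.4 (v), p. 11): "`G' → G` restricts to a connected covering over `G_e`
and to trivial coverings over all `G_{e'}`, `e' ≠ e`" reads `Π_e · H' = Π_G` and `Π_{e'} ≤ H'`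
for `e' ≠ e` — conjugates being irrelevant modulo the normal subgroup `H'`, and `Π_G · γ · Π_e`
being all of `Π_G`. [cite: MochizukiCombGC2007, Def 1.4(v) p.11] -/
theorem purelyTotallyRamified_top_iff {ι : Type*} (S : ι → Subgroup P) (H' : Subgroup P)
    [H'.Normal] :
    (∃ (i : ι) (γ : ConjAct P), (⊤ ⊓ γ • S i) ⊔ H' = ⊤ ∧
        ∀ (j : ι) (γ' : ConjAct P), (j ≠ i ∨ ConjAct.ofConjAct γ' ∉
            DoubleCoset.doubleCoset (ConjAct.ofConjAct γ) ((⊤ : Subgroup P) : Set P)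
              (S i : Set P)) → ⊤ ⊓ γ' • S j ≤ H') ↔
      ∃ i, S i ⊔ H' = ⊤ ∧ ∀ j, j ≠ i → S j ≤ H' := by
  simp only [top_inf_eq]
  constructor
  · rintro ⟨i, γ, hi, hj⟩
    refine ⟨i, (smul_sup_eq_top_iff γ (S i) H').mp hi, fun j hji => ?_⟩
    have := hj j 1 (Or.inl hji)
    rwa [one_smul] at this
  · rintro ⟨i, hi, hj⟩
    refine ⟨i, 1, by rwa [one_smul], fun j γ' h => ?_⟩
    rcases h with hji | hmem
    · exact (smul_le_normal_iff γ' (S j) H').mpr (hj j hji)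
    · exact absurd (mem_doubleCoset_top _ _ _) hmem

omit [TopologicalSpace P] in
/-- **The count criterion for purely total ramification** ([CombGC] Rmk. 1.4.2, p. 11, in
subgroup terms): for `H' ⊴ Π` of index `l ^ k` (`l` prime, `0 < k`) and finitely many subgroups
`S i` (the `Π_c`, or the `Π_v`), "some `S i · H' = Π` and all other `S j ≤ H'`" iff
`Σ_i [Π : H' · S i] = l ^ k · (#ι − 1) + 1`. [cite: MochizukiCombGC2007, Rmk 1.4.2 p.11] -/
theorem exists_total_iff_sum_index {ι : Type*} [Fintype ι] [DecidableEq ι] (S : ι → Subgroup P)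
    {l k : ℕ} (hl : l.Prime) (hk : 0 < k) (H' : Subgroup P) [H'.Normal]
    (hidx : H'.index = l ^ k) :
    (∃ i, S i ⊔ H' = ⊤ ∧ ∀ j, j ≠ i → S j ≤ H') ↔
      ((∑ i, (H' ⊔ S i).index : ℕ) : ℤ) = (H'.index : ℤ) * ((Fintype.card ι : ℤ) - 1) + 1 := by
  have hq : ∀ i, (H' ⊔ S i).index ∣ l ^ k := fun i =>
    hidx ▸ Subgroup.index_dvd_of_le le_sup_left
  have hne : l ^ k ≠ 0 := (pow_pos hl.pos k).ne'
  rw [hidx, PSCCounting.sum_quot_eq_iff hl hk _ hq]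
  refine exists_congr fun i => and_congr ?_ (forall_congr' fun j => imp_congr_right fun _ => ?_)
  · rw [sup_comm, Subgroup.index_eq_one]
  · constructor
    · intro h
      rw [sup_of_le_left h, hidx]
    · intro h
      have hmul := Subgroup.relIndex_mul_index (le_sup_left : H' ≤ H' ⊔ S j)
      rw [h, hidx] at hmul
      have h1 : H'.relIndex (H' ⊔ S j) = 1 :=
        Nat.eq_of_mul_eq_mul_right (Nat.pos_of_ne_zero hne) (by rw [one_mul]; exact hmul)
      exact le_sup_right.trans (Subgroup.relIndex_eq_one.mp h1)

end Conj

variable (G : PSCDatum P)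

/-! ### [CombGC] Remark 1.4.2 / [IUTchI] Remark 1.2.3 (iii): the three counts -/

section Counts

variable [IsTopologicalGroup P]

omit [IsTopologicalGroup P] in
/-- `Σ = {l}` makes `l` prime. [cite: MochizukiCombGC2007, Def 1.1(i) p.6] -/
theorem prime_of_sigma_eq {l : ℕ} (h : G.Sigma = {l}) : l.Prime :=
  G.sigma_prime l (by rw [h]; exact Set.mem_singleton l)

omit [IsTopologicalGroup P] in
/-- The trivial covering `G_{H'} → G = G_Π` is Galois for `H' ⊴ Π_G` open.
[cite: MochizukiCombGC2007, Def 1.4(v) p.11] -/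
theorem isGaloisCovering_top {H' : Subgroup P} [H'.Normal] (hO : IsOpen (H' : Set P)) :
    IsGaloisCovering ⊤ H' :=
  ⟨le_top, hO, by rw [Subgroup.coe_top]; exact isOpen_univ, inferInstance⟩

omit [IsTopologicalGroup P] in
/-- **[CombGC] Remark 1.4.2, first claim** (p. 11; degree a positive power of `l` as in [IUTchI]
Rmk. 1.2.3 (iii)), PROVED for every datum: `G' → G` Galois of degree `l ^ k`, `0 < k`, is
cuspidally purely totally ramified iff `r(G') = deg(G'/G) · (r(G) − 1) + 1`.
[cite: MochizukiCombGC2007, Rmk 1.4.2 p.11] -/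
theorem cuspidalPureRamificationCount : G.CuspidalPureRamificationCount := by
  intro l k H' hS hk hN hO hidx
  have hl := G.prime_of_sigma_eq hS
  unfold IsCuspidallyPurelyTotallyRamified
  rw [and_iff_right (isGaloisCovering_top hO), purelyTotallyRamified_top_iff G.cuspGp H',
    exists_total_iff_sum_index G.cuspGp hl hk H' hidx, G.cuspCount_eq_sum_index H']
  rfl

/-- **[CombGC] Remark 1.4.2, second claim** / [IUTchI] Rmk. 1.2.3 (iii) (p. 11 / p. 41), PROVED
for every datum: for a Galois `Π^unr_G`-covering of degree `l ^ k`, `0 < k`, one has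
`n(G') = n(G) · deg(G'/G)`, and `G' → G` is verticially purely totally ramified iff
`i(G') = deg(G'/G) · (i(G) − 1) + 1`. [cite: MochizukiCombGC2007, Rmk 1.4.2 p.11] -/
theorem verticialPureRamificationCount : G.VerticialPureRamificationCount := by
  intro l k H' hS hk hN hO hidx hunr
  have hl := G.prime_of_sigma_eq hS
  refine ⟨G.nodeCount_eq_of_isUnrCovering hunr, ?_⟩
  unfold IsVerticiallyPurelyTotallyRamified
  rw [and_iff_right (isGaloisCovering_top hO), purelyTotallyRamified_top_iff G.vertGp H',
    exists_total_iff_sum_index G.vertGp hl hk H' hidx, G.vertCount_eq_sum_index H']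
  rfl

/-- **[CombGC] Remark 1.4.2, third claim** / [IUTchI] Rmk. 1.2.3 (iii), third display (p. 11 /
p. 41), PROVED for every datum: for a Galois `Π^unr_G`-covering the equality
`i(G') = deg · (i(G) − 1) + 1` is equivalent to `i(G') − n(G') = deg · (i(G) − n(G) − 1) + 1`
(because `n(G') = deg · n(G)`). [cite: MochizukiCombGC2007, Rmk 1.4.2 p.11] -/
theorem verticialMinusNodalCount : G.VerticialMinusNodalCount := by
  intro l k H' _ hN _ _ hunr
  rw [G.nodeCount_eq_of_isUnrCovering hunr]
  push_cast
  constructor <;> intro h <;> linarith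

/-- **[CombGC] Remark 1.4.2 as printed over the origin parameter**: `RamificationCountsHold Ω`
holds for EVERY `Ω` (the three claims hold for every datum, geometric or not).
[cite: MochizukiCombGC2007, Rmk 1.4.2 p.11] -/
theorem ramificationCountsHold (Ω : PSCOrigin.{u}) : RamificationCountsHold Ω := by
  intro Q _ _ _ G _
  exact ⟨G.cuspidalPureRamificationCount, G.verticialPureRamificationCount,
    G.verticialMinusNodalCount⟩

end Counts

/-! ### [IUTchI] Remark 1.2.3 (iv), verticial part, second claim -/

section Elementary

variable [IsTopologicalGroup P]

/-- **[IUTchI] Remark 1.2.3 (iv), second verticial claim** (p. 42), PROVED for every datum (and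
without the sturdiness / elementary-abelian hypotheses, which the typed subgroup form does not
need): the Galois covering `G_{H'} → G` is verticially purely totally ramified iff some `Π_v`
surjects onto `Π_G / H'` while all other `Π_{v'}` die in it.
[cite: Mochizuki2012, IUTchI Rmk 1.2.3(iv) p.42] -/
theorem elementaryQuotientVerticiallyRamifiedIff : G.ElementaryQuotientVerticiallyRamifiedIff := by
  intro _ l H' _ hN hO _ _
  unfold IsVerticiallyPurelyTotallyRamified
  rw [and_iff_right (isGaloisCovering_top hO), purelyTotallyRamified_top_iff G.vertGp H']

end Elementary

end PSCDatum

end Literature.AnabelianGeometry.SemiGraphs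

end
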